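import Literature.MathematicalPhysics.QuantumLattice.HubbardFillingBoxEnergyBounds
import Literature.MathematicalPhysics.QuantumLattice.HubbardTTPrimeBoxWordExtension
import Literature.Computation.Certificates.BoxCoveringByCells
import Mathlib.Order.Interval.Set.Pi
import Mathlib.Data.Fin.VecNotation
import HarnessLib

/-!
# AFFINE box words for the `t–t'` Hubbard energy density: an affine floor / cap on a
# `(U, t', n)` cell is certified by eight rational corner inequalities

Family `hubbard` (topic `MathematicalPhysics/QuantumLattice`); written for stage S2 of the Hubbard
material oracle ("points → boxes", D-0096/D-0097), companion of `HubbardTTPrimeBoxWordCovering`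
(constant cell words ⇒ constant box word) and `HubbardTTPrimeBoxWordExtension` (reading a cell word
outside its cell). The words landed so far are CONSTANT on their box:
`F ≤ e(t, θ 1, θ 0, θ 2) ≤ C` for `θ ∈ Set.Icc ![U₁, s₁, n₁] ![U₂, s₂, n₂]` (coordinates
`θ 0 = U`, `θ 1 = t' = s`, `θ 2 = n`; `e = energyDensityTT'` takes `(t, t', U, n)`), and their width
`C − F` pays for the oscillation of `e` over the box. An AFFINE word
`L₀ + L₁ U + L₂ s + L₃ n ≤ e ≤ H₀ + H₁ U + H₂ s + H₃ n` follows the energy across the box; its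
pointwise width `(H − L)(θ)` is what a consumer at a point of the box actually gets.

Nothing new is solved. The two structural facts used are already in the tree:

* `(t', U) ↦ e(t, t', U, n)` is JOINTLY CONCAVE on `{U ≥ 0}` (`concaveOn_energyDensityTT'_tPrime_U`,
  tangent-functional / Gibbs-variational concavity of a ground-state energy in the couplings);
* `n ↦ e(t, t', U, n)` is CONVEX on `[0, 2)` (`convexOn_energyDensityTT'`, read through the density
  chord `energyDensityTT'_le_density_chord_of_mem_Icc`).

Consequences (the whole content of this file):

* §1 AFFINE BOOKKEEPING. An affine function of one / two variables that is `≥ 0` at the ends of a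
  segment / the four corners of a rectangle is `≥ 0` on it (`affine_nonneg_on_Icc`,
  `affine₂_nonneg_on_rect`) — the only "interval arithmetic" an affine word needs.
* §2 AFFINE FLOOR ON A CELL (`energyDensityTT'_affineFloor_Icc₃_of_cornerRows`). Data: at each of the
  four `(U, t')`-corners of the cell an affine-in-density floor on the density slab
  (`a + b·m ≤ e(t, s_j, U_i, m)` for `m ∈ [n₁, n₂]` — a kernel Fermi-sea tangent row, a certified
  `n`-tangent / `n`-sheet of a node, or on a face `n₁ = n₂` just a point floor). Then an affine `L` is
  a floor on the WHOLE cell as soon as the eight numbers `L(U_i, s_j, n_c)` are below the corner rows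
  at the slab ends: `e − L` is concave in `(t', U)` at fixed `n`, so its minimum over the rectangle sits
  at a corner (the point is a convex combination of the corners — `exists_convexWeights_Icc` — and
  Jensen, `energyDensityTT'_ge_convexComb`), where it is affine in `n` and checked at `n₁, n₂`.
  NO bilinear interpolant and no Lipschitz constant enter.
* §3 AFFINE CAP ON A CELL (`energyDensityTT'_affineCap_Icc₃_of_endPlanes`). Data: two cap PLANES,
  affine in `(U, t')` and valid on the cell's rectangle, at the two slab-end densities `n₁ < n₂`
  (a refereed VARBOX plane, a Hartree–Fock / polarised-sea plane, a constant cap).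
  Then an affine `H` is a cap on the whole cell as soon as the eight numbers `H(U_i, s_j, n_c)` are
  above the planes at the corners: the density chord of the two planes caps `e` (convexity in `n`),
  it is affine in `(U, t')` at fixed `n`, and `H −` it is checked at the rectangle's corners (§1).
  Face version (`n₁ = n₂`): `energyDensityTT'_affineCap_Icc₃_of_facePlane`.
* §4 BOOKKEEPING ON BOXES: gluing two overlapping cells along `U` / `t'` / `n`
  (`forall_Icc₃_glue_U/_tPrime/_density`, any predicate), the open-above-`U` extension of an affine
  floor with `L₁ ≤ 0` at zero loss (`affineFloor_Icc₃_extend_U_above`, monotonicity in `U`), the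
  below-`U` extension of a cap frozen at `U₁` (`affineCap_Icc₃_extend_U_below`), and the two-sided
  AFFINE WORD `affword_Icc₃_of_floor_of_cap` — literally the shape
  `∀ θ ∈ Set.Icc lo hi, L₀ + L₁ * θ 0 + L₂ * θ 1 + L₃ * θ 2 ≤ e t (θ 1) (θ 0) (θ 2) ∧ e … ≤ H₀ + …`
  the cell's harvester reads (`…_affword_Icc`); and the vertex envelope affine word ⇒ constant word
  (`constWord_of_affword_Icc₃`). Adapters from the producers' row / plane shapes to the hypotheses of
  §2–§3 live in the companion `HubbardTTPrimeAffineBoxWordAdapters`.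

How the coefficients are CHOSEN is not this file's business (offline: a small exact LP minimising the
largest vertex value of `H − L` subject to the sixteen corner inequalities); the kernel only checks the
inequalities (`norm_num`) and applies §2–§3. A box meeting several cells: certify the SAME `(L, H)` on
each cell and glue (§4), or issue one affine word per cell.

WHAT THIS IS NOT: a number; a new bound at any anchor; a statement about phases. Caps do not follow
from corner data by concavity (only floors do) — §3 needs planes valid on the whole rectangle.

## Mathlib / tree search

`lean search 'affword|affine.*corner|bilinear.*energyDensity'`: nothing of this kind in the tree; the
constant-word devices are `HubbardTTPrimeBoxWordCovering` §1/§4/§5 (corner-min floors, endpoint-max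
caps), `…boxword_cuprateFamily_xl_devices` (Summits side: bilinear corner interpolant evaluated to a
constant). Used: `concaveOn_energyDensityTT'_tPrime_U` via `energyDensityTT'_ge_convexComb`
(`HubbardNNNHoppingEnergyDensityRegionBounds`), `energyDensityTT'_le_density_chord_of_mem_Icc`
(`HubbardFillingBoxEnergyBounds`), `energyDensityTT'_mono_U`, `exists_convexWeights_Icc`
(`Computation/Certificates/BoxCoveringByCells`), `mem_Icc_vec3_iff` (`HubbardTTPrimeBoxWordExtension`).

## References

* R. B. Israel, *Convexity in the Theory of Lattice Gases*, Princeton 1979, Thm. I.3.4 (concavity of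
  the ground-state / free energy in the interaction; tangent functionals). [cite: Israel1979, Thm. I.3.4]
* D. Ruelle, *Statistical Mechanics: Rigorous Results*, 1969, §3.3 (convexity of thermodynamic-limit
  densities in the particle density). [cite: Ruelle1969, §3.3]
* R. T. Rockafellar, *Convex Analysis*, Princeton 1970, §32 Thm 32.2 / Cor. 32.3.4 (the infimum of a
  concave function over a polytope is attained at a vertex). [cite: Rockafellar1970, Thm 32.2]
* A. Neumaier, *Complete search in continuous global optimization and constraint satisfaction*, Acta
  Numerica 13 (2004), §11–§12 (linear / affine relaxations on boxes; sub-box bookkeeping).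
  [cite: Neumaier2004CompleteSearch, §12]
-/

noncomputable section

namespace Literature.MathematicalPhysics.QuantumLattice

namespace ThermodynamicLimit

open Set
open Literature.Computation.Certificates.BoxCovering

/-! ### §1 Affine bookkeeping: nonnegativity on a segment / rectangle from the ends / corners -/

/-- An affine function of one real variable which is `≥ 0` at both ends of a segment is `≥ 0` on the
segment (the point is a convex combination of the ends). [cite: Rockafellar1970, Thm 32.2] -/
theorem affine_nonneg_on_Icc {x₁ x₂ x α β : ℝ} (h₁ : x₁ ≤ x) (h₂ : x ≤ x₂)
    (c₁ : 0 ≤ α + β * x₁) (c₂ : 0 ≤ α + β * x₂) : 0 ≤ α + β * x := by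
  obtain ⟨l, m, hl, hm, hlm, hx⟩ := exists_convexWeights_Icc h₁ h₂
  have e : α + β * x = l * (α + β * x₁) + m * (α + β * x₂) := by
    rw [← hx]; linear_combination (-α) * hlm
  rw [e]
  exact add_nonneg (mul_nonneg hl c₁) (mul_nonneg hm c₂)

/-- An affine function of two real variables which is `≥ 0` at the four corners of a rectangle is
`≥ 0` on the rectangle. [cite: Rockafellar1970, Thm 32.2] -/
theorem affine₂_nonneg_on_rect {x₁ x₂ y₁ y₂ x y α β γ : ℝ} (hx₁ : x₁ ≤ x) (hx₂ : x ≤ x₂)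
    (hy₁ : y₁ ≤ y) (hy₂ : y ≤ y₂)
    (c₁₁ : 0 ≤ α + β * x₁ + γ * y₁) (c₁₂ : 0 ≤ α + β * x₁ + γ * y₂)
    (c₂₁ : 0 ≤ α + β * x₂ + γ * y₁) (c₂₂ : 0 ≤ α + β * x₂ + γ * y₂) :
    0 ≤ α + β * x + γ * y := by
  have h₁ : 0 ≤ (α + β * x₁) + γ * y := affine_nonneg_on_Icc hy₁ hy₂ c₁₁ c₁₂
  have h₂ : 0 ≤ (α + β * x₂) + γ * y := affine_nonneg_on_Icc hy₁ hy₂ c₂₁ c₂₂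
  have h := affine_nonneg_on_Icc (α := α + γ * y) (β := β) hx₁ hx₂ (by linarith) (by linarith)
  linarith

/-! ### §2 Affine FLOOR on a `(U, t', n)` cell from the four corner rows (joint concavity in `(t', U)`) -/

/-- **Affine floor on a cell from four corner rows.** Cell `[U₁, U₂] × [s₁, s₂] × [n₁, n₂]`
(`U₁ ≥ 0`, `0 ≤ n₁`, `n₂ < 2`; coordinates `θ 0 = U`, `θ 1 = t'`, `θ 2 = n`); at each corner
`(U_i, s_j)` an affine-in-density floor `a_ij + b_ij·m ≤ e(t, s_j, U_i, m)` for `m ∈ [n₁, n₂]`; and an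
affine candidate `L(U, s, n) = L₀ + L₁ U + L₂ s + L₃ n` whose eight corner values `L(U_i, s_j, n_c)`
are below the rows, `≤ a_ij + b_ij·n_c` (`c = 1, 2`). Then `L ≤ e` on the whole cell: at fixed `n`,
`e − L` is concave in `(t', U)` on the rectangle, so it is bounded below by its corner values (the point
is a convex combination of the corners; Jensen), and at a corner `a_ij + b_ij n − L(U_i, s_j, n)` is
affine in `n`, nonnegative at `n₁, n₂`. [cite: Israel1979, Thm. I.3.4] -/
theorem energyDensityTT'_affineFloor_Icc₃_of_cornerRows (t : ℝ) {U₁ U₂ s₁ s₂ n₁ n₂ : ℝ}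
    (hU₁ : 0 ≤ U₁) (hn0 : 0 ≤ n₁) (hn2 : n₂ < 2)
    {a₁₁ b₁₁ a₁₂ b₁₂ a₂₁ b₂₁ a₂₂ b₂₂ : ℝ}
    (h₁₁ : ∀ m ∈ Set.Icc n₁ n₂, a₁₁ + b₁₁ * m ≤ energyDensityTT' t s₁ U₁ m)
    (h₁₂ : ∀ m ∈ Set.Icc n₁ n₂, a₁₂ + b₁₂ * m ≤ energyDensityTT' t s₂ U₁ m)
    (h₂₁ : ∀ m ∈ Set.Icc n₁ n₂, a₂₁ + b₂₁ * m ≤ energyDensityTT' t s₁ U₂ m)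
    (h₂₂ : ∀ m ∈ Set.Icc n₁ n₂, a₂₂ + b₂₂ * m ≤ energyDensityTT' t s₂ U₂ m)
    {L₀ L₁ L₂ L₃ : ℝ}
    (c₁₁₁ : L₀ + L₁ * U₁ + L₂ * s₁ + L₃ * n₁ ≤ a₁₁ + b₁₁ * n₁)
    (c₁₁₂ : L₀ + L₁ * U₁ + L₂ * s₁ + L₃ * n₂ ≤ a₁₁ + b₁₁ * n₂)
    (c₁₂₁ : L₀ + L₁ * U₁ + L₂ * s₂ + L₃ * n₁ ≤ a₁₂ + b₁₂ * n₁)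
    (c₁₂₂ : L₀ + L₁ * U₁ + L₂ * s₂ + L₃ * n₂ ≤ a₁₂ + b₁₂ * n₂)
    (c₂₁₁ : L₀ + L₁ * U₂ + L₂ * s₁ + L₃ * n₁ ≤ a₂₁ + b₂₁ * n₁)
    (c₂₁₂ : L₀ + L₁ * U₂ + L₂ * s₁ + L₃ * n₂ ≤ a₂₁ + b₂₁ * n₂)
    (c₂₂₁ : L₀ + L₁ * U₂ + L₂ * s₂ + L₃ * n₁ ≤ a₂₂ + b₂₂ * n₁)
    (c₂₂₂ : L₀ + L₁ * U₂ + L₂ * s₂ + L₃ * n₂ ≤ a₂₂ + b₂₂ * n₂) :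
    ∀ θ ∈ Set.Icc (![U₁, s₁, n₁] : Fin 3 → ℝ) ![U₂, s₂, n₂],
      L₀ + L₁ * θ 0 + L₂ * θ 1 + L₃ * θ 2 ≤ energyDensityTT' t (θ 1) (θ 0) (θ 2) := by
  intro θ hθ
  obtain ⟨⟨hu₁, hu₂⟩, ⟨hs₁, hs₂⟩, ⟨hm₁, hm₂⟩⟩ := mem_Icc_vec3_iff.1 hθ
  have hn0' : 0 ≤ θ 2 := hn0.trans hm₁
  have hn2' : θ 2 < 2 := lt_of_le_of_lt hm₂ hn2
  have hU₂ : 0 ≤ U₂ := hU₁.trans (hu₁.trans hu₂)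
  have hmem : θ 2 ∈ Set.Icc n₁ n₂ := ⟨hm₁, hm₂⟩
  -- the four corner values of `L` at density `θ 2` are floors there
  have f₁₁ : L₀ + L₁ * U₁ + L₂ * s₁ + L₃ * θ 2 ≤ energyDensityTT' t s₁ U₁ (θ 2) := by
    have h0 : 0 ≤ (a₁₁ - (L₀ + L₁ * U₁ + L₂ * s₁)) + (b₁₁ - L₃) * θ 2 :=
      affine_nonneg_on_Icc hm₁ hm₂ (by linarith) (by linarith)
    linarith [h₁₁ (θ 2) hmem]
  have f₁₂ : L₀ + L₁ * U₁ + L₂ * s₂ + L₃ * θ 2 ≤ energyDensityTT' t s₂ U₁ (θ 2) := by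
    have h0 : 0 ≤ (a₁₂ - (L₀ + L₁ * U₁ + L₂ * s₂)) + (b₁₂ - L₃) * θ 2 :=
      affine_nonneg_on_Icc hm₁ hm₂ (by linarith) (by linarith)
    linarith [h₁₂ (θ 2) hmem]
  have f₂₁ : L₀ + L₁ * U₂ + L₂ * s₁ + L₃ * θ 2 ≤ energyDensityTT' t s₁ U₂ (θ 2) := by
    have h0 : 0 ≤ (a₂₁ - (L₀ + L₁ * U₂ + L₂ * s₁)) + (b₂₁ - L₃) * θ 2 :=
      affine_nonneg_on_Icc hm₁ hm₂ (by linarith) (by linarith)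
    linarith [h₂₁ (θ 2) hmem]
  have f₂₂ : L₀ + L₁ * U₂ + L₂ * s₂ + L₃ * θ 2 ≤ energyDensityTT' t s₂ U₂ (θ 2) := by
    have h0 : 0 ≤ (a₂₂ - (L₀ + L₁ * U₂ + L₂ * s₂)) + (b₂₂ - L₃) * θ 2 :=
      affine_nonneg_on_Icc hm₁ hm₂ (by linarith) (by linarith)
    linarith [h₂₂ (θ 2) hmem]
  -- barycentric weights along `t'` and along `U`
  obtain ⟨l, m, hl, hm, hlm, hx⟩ := exists_convexWeights_Icc hs₁ hs₂
  obtain ⟨l', m', hl', hm', hlm', hy⟩ := exists_convexWeights_Icc hu₁ hu₂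
  have hm_eq : m = 1 - l := by linarith
  have hm'_eq : m' = 1 - l' := by linarith
  subst hm_eq hm'_eq
  -- Jensen along `t'` at `U₁` and at `U₂`, then along `U`
  have g₁ := energyDensityTT'_ge_convexComb t hn0' hn2' hU₁ hU₁ hl hm hlm f₁₁ f₁₂
  have g₂ := energyDensityTT'_ge_convexComb t hn0' hn2' hU₂ hU₂ hl hm hlm f₂₁ f₂₂
  rw [hx, show l * U₁ + (1 - l) * U₁ = U₁ by ring] at g₁
  rw [hx, show l * U₂ + (1 - l) * U₂ = U₂ by ring] at g₂
  have g := energyDensityTT'_ge_convexComb t hn0' hn2' hU₁ hU₂ hl' hm' hlm' g₁ g₂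
  rw [hy, show l' * θ 1 + (1 - l') * θ 1 = θ 1 by ring] at g
  have e : L₀ + L₁ * θ 0 + L₂ * θ 1 + L₃ * θ 2 =
      l' * (l * (L₀ + L₁ * U₁ + L₂ * s₁ + L₃ * θ 2) + (1 - l) * (L₀ + L₁ * U₁ + L₂ * s₂ + L₃ * θ 2)) +
        (1 - l') * (l * (L₀ + L₁ * U₂ + L₂ * s₁ + L₃ * θ 2) +
          (1 - l) * (L₀ + L₁ * U₂ + L₂ * s₂ + L₃ * θ 2)) := by
    rw [← hx, ← hy]; ring
  rw [e]
  exact g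

/-! ### §3 Affine CAP on a `(U, t', n)` cell from two end-density planes (convexity in `n`) -/

/-- **Affine cap on a cell from two end-density planes.** Cell `[U₁, U₂] × [s₁, s₂] × [n₁, n₂]`
(`U₁ ≥ 0`, `0 ≤ n₁ < n₂ < 2`); two cap planes, affine in `(U, t')` and valid on the rectangle, at the
slab ends: `e(t, s, u, n_c) ≤ P_c + Q_c u + R_c s` (`c = 1, 2`); and an affine candidate
`H(U, s, n) = H₀ + H₁ U + H₂ s + H₃ n` whose eight corner values are above the planes,
`P_c + Q_c U_i + R_c s_j ≤ H(U_i, s_j, n_c)`. Then `e ≤ H` on the whole cell: `e(t, s, u, ·)` is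
convex in the density, hence below the chord of the two planes at `(u, s)`; the chord is affine in
`(u, s)` at fixed `n`, `H` is above it at the rectangle's corners, hence on the rectangle (§1).
[cite: Ruelle1969, §3.3] -/
theorem energyDensityTT'_affineCap_Icc₃_of_endPlanes (t : ℝ) {U₁ U₂ s₁ s₂ n₁ n₂ : ℝ}
    (hU₁ : 0 ≤ U₁) (hn0 : 0 ≤ n₁) (hn : n₁ < n₂) (hn2 : n₂ < 2)
    {P₁ Q₁ R₁ P₂ Q₂ R₂ : ℝ}
    (hC₁ : ∀ u s : ℝ, U₁ ≤ u → u ≤ U₂ → s₁ ≤ s → s ≤ s₂ →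
      energyDensityTT' t s u n₁ ≤ P₁ + Q₁ * u + R₁ * s)
    (hC₂ : ∀ u s : ℝ, U₁ ≤ u → u ≤ U₂ → s₁ ≤ s → s ≤ s₂ →
      energyDensityTT' t s u n₂ ≤ P₂ + Q₂ * u + R₂ * s)
    {H₀ H₁ H₂ H₃ : ℝ}
    (c₁₁₁ : P₁ + Q₁ * U₁ + R₁ * s₁ ≤ H₀ + H₁ * U₁ + H₂ * s₁ + H₃ * n₁)
    (c₁₂₁ : P₁ + Q₁ * U₁ + R₁ * s₂ ≤ H₀ + H₁ * U₁ + H₂ * s₂ + H₃ * n₁)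
    (c₂₁₁ : P₁ + Q₁ * U₂ + R₁ * s₁ ≤ H₀ + H₁ * U₂ + H₂ * s₁ + H₃ * n₁)
    (c₂₂₁ : P₁ + Q₁ * U₂ + R₁ * s₂ ≤ H₀ + H₁ * U₂ + H₂ * s₂ + H₃ * n₁)
    (c₁₁₂ : P₂ + Q₂ * U₁ + R₂ * s₁ ≤ H₀ + H₁ * U₁ + H₂ * s₁ + H₃ * n₂)
    (c₁₂₂ : P₂ + Q₂ * U₁ + R₂ * s₂ ≤ H₀ + H₁ * U₁ + H₂ * s₂ + H₃ * n₂)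
    (c₂₁₂ : P₂ + Q₂ * U₂ + R₂ * s₁ ≤ H₀ + H₁ * U₂ + H₂ * s₁ + H₃ * n₂)
    (c₂₂₂ : P₂ + Q₂ * U₂ + R₂ * s₂ ≤ H₀ + H₁ * U₂ + H₂ * s₂ + H₃ * n₂) :
    ∀ θ ∈ Set.Icc (![U₁, s₁, n₁] : Fin 3 → ℝ) ![U₂, s₂, n₂],
      energyDensityTT' t (θ 1) (θ 0) (θ 2) ≤ H₀ + H₁ * θ 0 + H₂ * θ 1 + H₃ * θ 2 := by
  intro θ hθ
  obtain ⟨⟨hu₁, hu₂⟩, ⟨hs₁, hs₂⟩, ⟨hm₁, hm₂⟩⟩ := mem_Icc_vec3_iff.1 hθ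
  have hU0 : 0 ≤ θ 0 := hU₁.trans hu₁
  have hd : 0 < n₂ - n₁ := sub_pos.2 hn
  -- density chord of the two planes at `(θ 0, θ 1)`
  have hch := energyDensityTT'_le_density_chord_of_mem_Icc t (θ 1) hU0 hn0 hn hn2
    (hC₁ (θ 0) (θ 1) hu₁ hu₂ hs₁ hs₂) (hC₂ (θ 0) (θ 1) hu₁ hu₂ hs₁ hs₂) ⟨hm₁, hm₂⟩
  -- `H` is above each plane on the rectangle (corners ⇒ rectangle, §1)
  have k₁ : P₁ + Q₁ * θ 0 + R₁ * θ 1 ≤ H₀ + H₁ * θ 0 + H₂ * θ 1 + H₃ * n₁ := by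
    have h0 : 0 ≤ (H₀ + H₃ * n₁ - P₁) + (H₁ - Q₁) * θ 0 + (H₂ - R₁) * θ 1 :=
      affine₂_nonneg_on_rect hu₁ hu₂ hs₁ hs₂ (by linarith) (by linarith) (by linarith) (by linarith)
    linarith
  have k₂ : P₂ + Q₂ * θ 0 + R₂ * θ 1 ≤ H₀ + H₁ * θ 0 + H₂ * θ 1 + H₃ * n₂ := by
    have h0 : 0 ≤ (H₀ + H₃ * n₂ - P₂) + (H₁ - Q₂) * θ 0 + (H₂ - R₂) * θ 1 :=
      affine₂_nonneg_on_rect hu₁ hu₂ hs₁ hs₂ (by linarith) (by linarith) (by linarith) (by linarith)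
    linarith
  have w₁ := mul_le_mul_of_nonneg_left k₁ (sub_nonneg.2 hm₂)
  have w₂ := mul_le_mul_of_nonneg_left k₂ (sub_nonneg.2 hm₁)
  refine hch.trans ?_
  rw [div_le_iff₀ hd]
  linarith

/-- **Affine cap on a FACE `n = n₀`** (`U₁ ≥ 0`) from one plane valid on the rectangle,
`e(t, s, u, n₀) ≤ P + Q u + R s`, and four corner inequalities `P + Q U_i + R s_j ≤ H(U_i, s_j, n₀)`:
`e ≤ H₀ + H₁ θ 0 + H₂ θ 1 + H₃ θ 2` on `Set.Icc ![U₁, s₁, n₀] ![U₂, s₂, n₀]`.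
[cite: Rockafellar1970, Thm 32.2] -/
theorem energyDensityTT'_affineCap_Icc₃_of_facePlane (t : ℝ) {U₁ U₂ s₁ s₂ n₀ : ℝ}
    {P Q R : ℝ}
    (hC : ∀ u s : ℝ, U₁ ≤ u → u ≤ U₂ → s₁ ≤ s → s ≤ s₂ →
      energyDensityTT' t s u n₀ ≤ P + Q * u + R * s)
    {H₀ H₁ H₂ H₃ : ℝ}
    (c₁₁ : P + Q * U₁ + R * s₁ ≤ H₀ + H₁ * U₁ + H₂ * s₁ + H₃ * n₀)
    (c₁₂ : P + Q * U₁ + R * s₂ ≤ H₀ + H₁ * U₁ + H₂ * s₂ + H₃ * n₀)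
    (c₂₁ : P + Q * U₂ + R * s₁ ≤ H₀ + H₁ * U₂ + H₂ * s₁ + H₃ * n₀)
    (c₂₂ : P + Q * U₂ + R * s₂ ≤ H₀ + H₁ * U₂ + H₂ * s₂ + H₃ * n₀) :
    ∀ θ ∈ Set.Icc (![U₁, s₁, n₀] : Fin 3 → ℝ) ![U₂, s₂, n₀],
      energyDensityTT' t (θ 1) (θ 0) (θ 2) ≤ H₀ + H₁ * θ 0 + H₂ * θ 1 + H₃ * θ 2 := by
  intro θ hθ
  obtain ⟨⟨hu₁, hu₂⟩, ⟨hs₁, hs₂⟩, ⟨hm₁, hm₂⟩⟩ := mem_Icc_vec3_iff.1 hθ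
  have hn : θ 2 = n₀ := le_antisymm hm₂ hm₁
  have h0 : 0 ≤ (H₀ + H₃ * n₀ - P) + (H₁ - Q) * θ 0 + (H₂ - R) * θ 1 :=
    affine₂_nonneg_on_rect hu₁ hu₂ hs₁ hs₂ (by linarith) (by linarith) (by linarith) (by linarith)
  have h := hC (θ 0) (θ 1) hu₁ hu₂ hs₁ hs₂
  rw [hn]
  linarith

/-! ### §4 Bookkeeping on boxes: gluing, `U`-extensions, the two-sided affine word -/

/-- **Gluing along `U`** (overlap allowed: `c' ≤ c`): a statement on `Set.Icc ![a₀,a₁,a₂] ![c,b₁,b₂]`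
and on `Set.Icc ![c',a₁,a₂] ![b₀,b₁,b₂]` holds on `Set.Icc ![a₀,a₁,a₂] ![b₀,b₁,b₂]`.
[cite: Neumaier2004CompleteSearch, §12] -/
theorem forall_Icc₃_glue_U {P : (Fin 3 → ℝ) → Prop} {a₀ a₁ a₂ b₀ b₁ b₂ c c' : ℝ} (hc : c' ≤ c)
    (h₁ : ∀ θ ∈ Set.Icc (![a₀, a₁, a₂] : Fin 3 → ℝ) ![c, b₁, b₂], P θ)
    (h₂ : ∀ θ ∈ Set.Icc (![c', a₁, a₂] : Fin 3 → ℝ) ![b₀, b₁, b₂], P θ) :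
    ∀ θ ∈ Set.Icc (![a₀, a₁, a₂] : Fin 3 → ℝ) ![b₀, b₁, b₂], P θ := by
  intro θ hθ
  obtain ⟨⟨k1, k2⟩, ⟨k3, k4⟩, ⟨k5, k6⟩⟩ := mem_Icc_vec3_iff.1 hθ
  rcases le_total (θ 0) c with h | h
  · exact h₁ θ (mem_Icc_vec3_iff.2 ⟨⟨k1, h⟩, ⟨k3, k4⟩, ⟨k5, k6⟩⟩)
  · exact h₂ θ (mem_Icc_vec3_iff.2 ⟨⟨hc.trans h, k2⟩, ⟨k3, k4⟩, ⟨k5, k6⟩⟩)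

/-- **Gluing along `t'`** (overlap allowed: `c' ≤ c`). [cite: Neumaier2004CompleteSearch, §12] -/
theorem forall_Icc₃_glue_tPrime {P : (Fin 3 → ℝ) → Prop} {a₀ a₁ a₂ b₀ b₁ b₂ c c' : ℝ} (hc : c' ≤ c)
    (h₁ : ∀ θ ∈ Set.Icc (![a₀, a₁, a₂] : Fin 3 → ℝ) ![b₀, c, b₂], P θ)
    (h₂ : ∀ θ ∈ Set.Icc (![a₀, c', a₂] : Fin 3 → ℝ) ![b₀, b₁, b₂], P θ) :
    ∀ θ ∈ Set.Icc (![a₀, a₁, a₂] : Fin 3 → ℝ) ![b₀, b₁, b₂], P θ := by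
  intro θ hθ
  obtain ⟨⟨k1, k2⟩, ⟨k3, k4⟩, ⟨k5, k6⟩⟩ := mem_Icc_vec3_iff.1 hθ
  rcases le_total (θ 1) c with h | h
  · exact h₁ θ (mem_Icc_vec3_iff.2 ⟨⟨k1, k2⟩, ⟨k3, h⟩, ⟨k5, k6⟩⟩)
  · exact h₂ θ (mem_Icc_vec3_iff.2 ⟨⟨k1, k2⟩, ⟨hc.trans h, k4⟩, ⟨k5, k6⟩⟩)

/-- **Gluing along the density** (overlap allowed: `c' ≤ c`). [cite: Neumaier2004CompleteSearch, §12] -/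
theorem forall_Icc₃_glue_density {P : (Fin 3 → ℝ) → Prop} {a₀ a₁ a₂ b₀ b₁ b₂ c c' : ℝ}
    (hc : c' ≤ c)
    (h₁ : ∀ θ ∈ Set.Icc (![a₀, a₁, a₂] : Fin 3 → ℝ) ![b₀, b₁, c], P θ)
    (h₂ : ∀ θ ∈ Set.Icc (![a₀, a₁, c'] : Fin 3 → ℝ) ![b₀, b₁, b₂], P θ) :
    ∀ θ ∈ Set.Icc (![a₀, a₁, a₂] : Fin 3 → ℝ) ![b₀, b₁, b₂], P θ := by
  intro θ hθ
  obtain ⟨⟨k1, k2⟩, ⟨k3, k4⟩, ⟨k5, k6⟩⟩ := mem_Icc_vec3_iff.1 hθ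
  rcases le_total (θ 2) c with h | h
  · exact h₁ θ (mem_Icc_vec3_iff.2 ⟨⟨k1, k2⟩, ⟨k3, k4⟩, ⟨k5, h⟩⟩)
  · exact h₂ θ (mem_Icc_vec3_iff.2 ⟨⟨k1, k2⟩, ⟨k3, k4⟩, ⟨hc.trans h, k6⟩⟩)

/-- **Open-above-`U` extension of an affine floor at zero loss.** An affine floor with `L₁ ≤ 0` on the
cell `[U₁, U₂] × [s₁, s₂] × [n₁, n₂]` (`0 ≤ U₁ ≤ U₂`, `0 ≤ n₁`, `n₂ < 2`) is a floor on
`[U₁, U₃] × [s₁, s₂] × [n₁, n₂]` for every `U₃`: above `U₂` the energy does not decrease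
(`energyDensityTT'_mono_U`) and `L` does not increase. [cite: BachLiebSolovej1994, eq. (2c.36)] -/
theorem affineFloor_Icc₃_extend_U_above (t : ℝ) {U₁ U₂ U₃ s₁ s₂ n₁ n₂ L₀ L₁ L₂ L₃ : ℝ}
    (hU₁ : 0 ≤ U₁) (hU : U₁ ≤ U₂) (hn0 : 0 ≤ n₁) (hn2 : n₂ < 2) (hL₁ : L₁ ≤ 0)
    (h : ∀ θ ∈ Set.Icc (![U₁, s₁, n₁] : Fin 3 → ℝ) ![U₂, s₂, n₂],
      L₀ + L₁ * θ 0 + L₂ * θ 1 + L₃ * θ 2 ≤ energyDensityTT' t (θ 1) (θ 0) (θ 2)) :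
    ∀ θ ∈ Set.Icc (![U₁, s₁, n₁] : Fin 3 → ℝ) ![U₃, s₂, n₂],
      L₀ + L₁ * θ 0 + L₂ * θ 1 + L₃ * θ 2 ≤ energyDensityTT' t (θ 1) (θ 0) (θ 2) := by
  intro θ hθ
  obtain ⟨⟨k1, _⟩, ⟨k3, k4⟩, ⟨k5, k6⟩⟩ := mem_Icc_vec3_iff.1 hθ
  rcases le_total (θ 0) U₂ with hu | hu
  · exact h θ (mem_Icc_vec3_iff.2 ⟨⟨k1, hu⟩, ⟨k3, k4⟩, ⟨k5, k6⟩⟩)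
  · have h₂ := h ![U₂, θ 1, θ 2] (mem_Icc_vec3_iff.2 ⟨⟨hU, le_rfl⟩, ⟨k3, k4⟩, ⟨k5, k6⟩⟩)
    simp only [Matrix.cons_val_zero, Matrix.cons_val_one, Matrix.cons_val] at h₂
    have hm := energyDensityTT'_mono_U t (θ 1) (hn0.trans k5) (lt_of_le_of_lt k6 hn2)
      (hU₁.trans hU) hu
    have hL : L₁ * θ 0 ≤ L₁ * U₂ := mul_le_mul_of_nonpos_left hu hL₁
    linarith

/-- **Below-`U` extension of an affine cap, frozen at `U₁`.** An affine cap on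
`[U₁, U₂] × [s₁, s₂] × [n₁, n₂]` (`0 ≤ U₀`, `U₁ ≤ U₂`, `0 ≤ n₁`, `n₂ < 2`) gives on the box below,
`[U₀, U₂] × …` the cap `max (H at U) (H at U₁)` coordinate-wise — stated as: for `θ 0 ≤ U₁` the cap
`H₀ + H₁ U₁ + H₂ θ 1 + H₃ θ 2` holds (`e` is nondecreasing in `U`). [cite: BachLiebSolovej1994, eq. (2c.36)] -/
theorem affineCap_Icc₃_extend_U_below (t : ℝ) {U₀ U₁ U₂ s₁ s₂ n₁ n₂ H₀ H₁ H₂ H₃ : ℝ}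
    (hU₀ : 0 ≤ U₀) (hU : U₁ ≤ U₂) (hn0 : 0 ≤ n₁) (hn2 : n₂ < 2)
    (h : ∀ θ ∈ Set.Icc (![U₁, s₁, n₁] : Fin 3 → ℝ) ![U₂, s₂, n₂],
      energyDensityTT' t (θ 1) (θ 0) (θ 2) ≤ H₀ + H₁ * θ 0 + H₂ * θ 1 + H₃ * θ 2) :
    ∀ θ ∈ Set.Icc (![U₀, s₁, n₁] : Fin 3 → ℝ) ![U₁, s₂, n₂],
      energyDensityTT' t (θ 1) (θ 0) (θ 2) ≤ (H₀ + H₁ * U₁) + 0 * θ 0 + H₂ * θ 1 + H₃ * θ 2 := by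
  intro θ hθ
  obtain ⟨⟨k1, k2⟩, ⟨k3, k4⟩, ⟨k5, k6⟩⟩ := mem_Icc_vec3_iff.1 hθ
  have h₁ := h ![U₁, θ 1, θ 2] (mem_Icc_vec3_iff.2 ⟨⟨le_rfl, hU⟩, ⟨k3, k4⟩, ⟨k5, k6⟩⟩)
  simp only [Matrix.cons_val_zero, Matrix.cons_val_one, Matrix.cons_val] at h₁
  have hm := energyDensityTT'_mono_U t (θ 1) (hn0.trans k5) (lt_of_le_of_lt k6 hn2)
    (hU₀.trans k1) k2
  linarith

/-- **The two-sided AFFINE WORD** on a box from an affine floor and an affine cap on it — literally the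
shape `∀ θ ∈ Set.Icc lo hi, L₀ + L₁ θ 0 + L₂ θ 1 + L₃ θ 2 ≤ e t (θ 1) (θ 0) (θ 2) ∧ e … ≤ H₀ + …`
read by the cell's harvester (`…_affword_Icc`). [cite: Neumaier2004CompleteSearch, §12] -/
theorem affword_Icc₃_of_floor_of_cap (t : ℝ) {lo hi : Fin 3 → ℝ} {L₀ L₁ L₂ L₃ H₀ H₁ H₂ H₃ : ℝ}
    (hL : ∀ θ ∈ Set.Icc lo hi, L₀ + L₁ * θ 0 + L₂ * θ 1 + L₃ * θ 2 ≤ energyDensityTT' t (θ 1) (θ 0) (θ 2))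
    (hH : ∀ θ ∈ Set.Icc lo hi, energyDensityTT' t (θ 1) (θ 0) (θ 2) ≤ H₀ + H₁ * θ 0 + H₂ * θ 1 + H₃ * θ 2) :
    ∀ θ ∈ Set.Icc lo hi,
      L₀ + L₁ * θ 0 + L₂ * θ 1 + L₃ * θ 2 ≤ energyDensityTT' t (θ 1) (θ 0) (θ 2) ∧
        energyDensityTT' t (θ 1) (θ 0) (θ 2) ≤ H₀ + H₁ * θ 0 + H₂ * θ 1 + H₃ * θ 2 :=
  fun θ hθ => ⟨hL θ hθ, hH θ hθ⟩

/-- **Affine word ⇒ constant word on the box** (vertex envelope): an affine two-sided word on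
`Set.Icc ![U₁,s₁,n₁] ![U₂,s₂,n₂]` with constants `F ≤ L` at the eight vertices and `H ≤ C` at the
eight vertices gives the constant window `F ≤ e ≤ C` there — the form the constant-cover meter and
the S1/S2 seam (`HoldsOn (EnergyWord F C)`) consume. [cite: Neumaier2004CompleteSearch, §12] -/
theorem constWord_of_affword_Icc₃ (t : ℝ) {U₁ U₂ s₁ s₂ n₁ n₂ L₀ L₁ L₂ L₃ H₀ H₁ H₂ H₃ F C : ℝ}
    (h : ∀ θ ∈ Set.Icc (![U₁, s₁, n₁] : Fin 3 → ℝ) ![U₂, s₂, n₂],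
      L₀ + L₁ * θ 0 + L₂ * θ 1 + L₃ * θ 2 ≤ energyDensityTT' t (θ 1) (θ 0) (θ 2) ∧
        energyDensityTT' t (θ 1) (θ 0) (θ 2) ≤ H₀ + H₁ * θ 0 + H₂ * θ 1 + H₃ * θ 2)
    (fL : ∀ u ∈ ({U₁, U₂} : Set ℝ), ∀ s ∈ ({s₁, s₂} : Set ℝ), ∀ m ∈ ({n₁, n₂} : Set ℝ),
      F ≤ L₀ + L₁ * u + L₂ * s + L₃ * m)
    (fH : ∀ u ∈ ({U₁, U₂} : Set ℝ), ∀ s ∈ ({s₁, s₂} : Set ℝ), ∀ m ∈ ({n₁, n₂} : Set ℝ),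
      H₀ + H₁ * u + H₂ * s + H₃ * m ≤ C) :
    ∀ θ ∈ Set.Icc (![U₁, s₁, n₁] : Fin 3 → ℝ) ![U₂, s₂, n₂],
      F ≤ energyDensityTT' t (θ 1) (θ 0) (θ 2) ∧ energyDensityTT' t (θ 1) (θ 0) (θ 2) ≤ C := by
  intro θ hθ
  obtain ⟨⟨k1, k2⟩, ⟨k3, k4⟩, ⟨k5, k6⟩⟩ := mem_Icc_vec3_iff.1 hθ
  obtain ⟨hl, hh⟩ := h θ hθ
  have m1 : U₁ ∈ ({U₁, U₂} : Set ℝ) := by simp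
  have m2 : U₂ ∈ ({U₁, U₂} : Set ℝ) := by simp
  have m3 : s₁ ∈ ({s₁, s₂} : Set ℝ) := by simp
  have m4 : s₂ ∈ ({s₁, s₂} : Set ℝ) := by simp
  have m5 : n₁ ∈ ({n₁, n₂} : Set ℝ) := by simp
  have m6 : n₂ ∈ ({n₁, n₂} : Set ℝ) := by simp
  constructor
  · -- `L − F` is affine and ≥ 0 at the vertices ⇒ ≥ 0 at θ (three nested segment steps)
    have a : ∀ u ∈ ({U₁, U₂} : Set ℝ), ∀ s ∈ ({s₁, s₂} : Set ℝ),
        0 ≤ (L₀ + L₁ * u + L₂ * s - F) + L₃ * θ 2 := fun u hu s hs =>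
      affine_nonneg_on_Icc k5 k6 (by linarith [fL u hu s hs n₁ m5]) (by linarith [fL u hu s hs n₂ m6])
    have b : 0 ≤ (L₀ + L₃ * θ 2 - F) + L₁ * θ 0 + L₂ * θ 1 :=
      affine₂_nonneg_on_rect k1 k2 k3 k4 (by linarith [a U₁ m1 s₁ m3]) (by linarith [a U₁ m1 s₂ m4])
        (by linarith [a U₂ m2 s₁ m3]) (by linarith [a U₂ m2 s₂ m4])
    linarith
  · have a : ∀ u ∈ ({U₁, U₂} : Set ℝ), ∀ s ∈ ({s₁, s₂} : Set ℝ),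
        0 ≤ (C - (H₀ + H₁ * u + H₂ * s)) + (-H₃) * θ 2 := fun u hu s hs =>
      affine_nonneg_on_Icc k5 k6 (by linarith [fH u hu s hs n₁ m5]) (by linarith [fH u hu s hs n₂ m6])
    have b : 0 ≤ (C - H₀ - H₃ * θ 2) + (-H₁) * θ 0 + (-H₂) * θ 1 :=
      affine₂_nonneg_on_rect k1 k2 k3 k4 (by linarith [a U₁ m1 s₁ m3]) (by linarith [a U₁ m1 s₂ m4])
        (by linarith [a U₂ m2 s₁ m3]) (by linarith [a U₂ m2 s₂ m4])
    linarith

end ThermodynamicLimit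

end Literature.MathematicalPhysics.QuantumLattice
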